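import Literature.RingTheory.MvPowerSeries.FrobeniusPowerBasis
import HarnessLib

/-!
# `A⟦X^q⟧` is inverse-closed: units of `A⟦X⟧` supported on `qℕ^σ` have inverses supported on `qℕ^σ`

Topic: `Literature/RingTheory/MvPowerSeries`. Complement to `FrobeniusPowerBasis.lean` (the `q`-adic monomial
decomposition `φ = Σ_{e : σ → Fin q} X^{ν(e)} φ_e`, [Matsumura1987] §30): the constant series `1` is supported on
`qℕ^σ`, and if `u · v = 1` with `u` supported on `qℕ^σ` then so is `v` — by uniqueness of the decomposition of
`1 = u v = Σ_e X^{ν(e)} (u v_e)`, all components `v_e` with `e ≠ 0` vanish. In prime characteristic with `q = p^ℓ`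
this says: the inverse of a unit of `ρ^ℓ(A⟦X⟧) = A⟦X^{p^ℓ}⟧`-type (a `p^ℓ`-th power) again lies in `A⟦X^{p^ℓ}⟧`
(for a unit `u = f^{p^ℓ}` directly: `u⁻¹ = (f⁻¹)^{p^ℓ}`; the support statement needs no Frobenius).

Source (read on the page): H. Matsumura, *Commutative Ring Theory* [Matsumura1987], §30 proof of Thm. 30.9
p.243–244 (lit key `book:matsumura1986-commutative-ring-theory`, PDF p.261–262): `B = k⟦x⟧` is free over
`C′ = k′⟦x^p⟧` on the `p`-monomials — WHAT THIS FILE PROVES is the elementary corollary «`A⟦X^q⟧` is closed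
under taking inverses in `A⟦X⟧`» of that freeness (uniqueness of coordinates), for any commutative ring `A` and
any `q ≥ 1`. NOT here: anything about Frobenius or perfectness.
-/

noncomputable section

open _root_.MvPowerSeries

namespace Literature.RingTheory.MvPowerSeries

universe u v

variable {σ : Type u} {R : Type v} [CommRing R]

/-- The constant series `1` is supported on multiples of every `q`. [cite: Matsumura1987, §30 proof of Thm. 30.9 p. 243] -/
theorem isSupportedOnMultiples_one [DecidableEq σ] (q : ℕ) : IsSupportedOnMultiples q (1 : MvPowerSeries σ R) := by
  rintro m ⟨i, hi⟩
  rw [coeff_one, if_neg]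
  rintro rfl
  exact hi (dvd_zero q)

/-- **`A⟦X^q⟧` is inverse-closed in `A⟦X⟧`**: if `u` is supported on `qℕ^σ` and `u · v = 1`, then `v` is
supported on `qℕ^σ`. Proof: decompose `v = Σ_e X^{ν(e)} v_e` (`q`-adic decomposition); then
`1 = u v = Σ_e X^{ν(e)} (u v_e)` with `u v_e ∈ A⟦X^q⟧`, so by uniqueness `u v_e = 0` for `e ≠ 0`, hence
`v_e = v (u v_e) = 0`, and `v = v_0 ∈ A⟦X^q⟧`. [cite: Matsumura1987, §30 proof of Thm. 30.9 p. 243] -/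
theorem IsSupportedOnMultiples.of_mul_eq_one [Fintype σ] [DecidableEq σ] {q : ℕ} [NeZero q]
    {u v : MvPowerSeries σ R} (hu : IsSupportedOnMultiples q u) (huv : u * v = 1) :
    IsSupportedOnMultiples q v := by
  classical
  have hv := eq_sum_monomial_mul_modComponent q v
  -- `1 = Σ_e X^{ν(e)} (u · v_e)`
  have h1 : (1 : MvPowerSeries σ R) =
      ∑ e : σ → Fin q, monomial (liftExp q e) (1 : R) * (u * modComponent q v e) := by
    rw [← huv]
    conv_lhs => rw [hv]
    rw [Finset.mul_sum]
    exact Finset.sum_congr rfl fun e _ => by ring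
  -- uniqueness of the decomposition of `1`
  have h2 : ∀ e : σ → Fin q, u * modComponent q v e = if e = 0 then 1 else 0 := fun e => by
    rw [← modComponent_eq_of_eq_sum q (fun e => u * modComponent q v e)
      (fun e => hu.mul (isSupportedOnMultiples_modComponent q v e)) h1 e,
      modComponent_of_isSupportedOnMultiples q (isSupportedOnMultiples_one q) e]
  -- components `e ≠ 0` of `v` vanish
  have h3 : ∀ e : σ → Fin q, e ≠ 0 → modComponent q v e = 0 := fun e he => by
    have := h2 e
    rw [if_neg he] at this
    calc modComponent q v e = v * (u * modComponent q v e) := by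
          rw [← mul_assoc, mul_comm v u, huv, one_mul]
      _ = 0 := by rw [this, mul_zero]
  -- hence `v = v_0`
  have h4 : v = modComponent q v 0 := by
    conv_lhs => rw [hv]
    rw [Finset.sum_eq_single (0 : σ → Fin q)]
    · rw [show liftExp q (0 : σ → Fin q) = 0 from by ext i; rfl]
      exact one_mul _
    · intro e _ he
      rw [h3 e he, mul_zero]
    · intro h
      exact absurd (Finset.mem_univ _) h
  rw [h4]
  exact isSupportedOnMultiples_modComponent q v 0

/-- The inverse of a unit of `A⟦X⟧` lying in `A⟦X^q⟧` lies in `A⟦X^q⟧`.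
[cite: Matsumura1987, §30 proof of Thm. 30.9 p. 243] -/
theorem IsSupportedOnMultiples.unit_inv [Fintype σ] [DecidableEq σ] {q : ℕ} [NeZero q]
    {u : (MvPowerSeries σ R)ˣ} (hu : IsSupportedOnMultiples q (u : MvPowerSeries σ R)) :
    IsSupportedOnMultiples q (↑u⁻¹ : MvPowerSeries σ R) :=
  hu.of_mul_eq_one u.mul_inv

end Literature.RingTheory.MvPowerSeries

end
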